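import Mathlib
import HarnessLib
import Summits.NavierStokesRegularity.NavierStokesRegularity.Theorems.TaylorModelRungThreeSoundnessSeries

/-!
# Line `taylor-model` on crux K1b-DR (`ExactWindowRungThree.DerivativeEnclosureCertificateR`,
# stmt-NavierStokesRegularity-23954) — stub S1 `stub_soundness`, helper 3: the Taylor series solves
# the equation

Toward the registered stub `stub_soundness : TaylorModelSoundness` (skeleton v3 `9391589be9c875b2`,
line owner ns-idea-2 g3; Part B1 of `S1-PROOFPLAN.md`). For a system `IsMajorantSystem n Q w b T U` and
`|x| ≤ m·w`, `b m r < 1`: the component Taylor series `σ ↦ Σ_k T x k c σ^k` is differentiable on `(-r, r)`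
term by term (Mathlib `hasDerivAt_tsum_of_isPreconnected`, dominated by `Σ k (bmr)^k`), and the
differentiated series equals `Q` of the series — coefficientwise this is the recursion
`(k+1) T x (k+1) = Σ_{i≤k} Q (T x i) (T x (k-i))`, summed by the real Cauchy product
(`tsum_mul_tsum_eq_tsum_sum_range_of_summable_norm`) after expanding the bilinear `Q` along the
coordinate basis (`Q_expand`). Result: `hasDerivAt_pseries_T` — on `[0, r)` the vector series has
derivative `Q (Σ T x k s^k) (Σ T x k s^k)`.

MODEL-lattice bookkeeping only (rung TL-M3 of the NS ladder); nothing here is a statement about the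
Navier–Stokes equations.
-/

noncomputable section

-- the sub-problem namespace repeats the summit name by design (D-0017)
set_option linter.dupNamespace false

namespace Summit.NavierStokesRegularity.NavierStokesRegularity.Theorems.TaylorModelMajorant

open scoped BigOperators Topology
open Finset Set Filter

variable {n : ℕ} {Q : (Fin n → ℝ) → (Fin n → ℝ) → Fin n → ℝ} {w : Fin n → ℝ} {b : ℝ}
  {T : (Fin n → ℝ) → ℕ → Fin n → ℝ} {U : (Fin n → ℝ) → (Fin n → ℝ) → ℕ → Fin n → ℝ}

namespace IsMajorantSystem

variable (h : IsMajorantSystem n Q w b T U)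
include h

/-! ### Coordinate expansion of the bilinear field -/

/-- Expansion of `Q` in the first argument along the coordinate basis. [folklore] -/
theorem Q_expand_left (u v : Fin n → ℝ) : Q u v = ∑ a, u a • Q (Pi.single a 1) v := by
  set Lv : (Fin n → ℝ) →ₗ[ℝ] (Fin n → ℝ) := IsLinearMap.mk' _ (h.linear_left v) with hLv
  have hu : ∑ a, u a • (Pi.single a (1 : ℝ) : Fin n → ℝ) = u := by
    conv_rhs => rw [← Finset.univ_sum_single u]
    exact Finset.sum_congr rfl fun a _ => by rw [← Pi.single_smul', smul_eq_mul, mul_one]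
  calc Q u v = Lv u := rfl
    _ = Lv (∑ a, u a • (Pi.single a (1 : ℝ) : Fin n → ℝ)) := by rw [hu]
    _ = ∑ a, u a • Lv (Pi.single a 1) := by rw [map_sum]; simp only [map_smul]
    _ = ∑ a, u a • Q (Pi.single a 1) v := rfl

/-- Expansion of `Q` in the second argument along the coordinate basis. [folklore] -/
theorem Q_expand_right (u v : Fin n → ℝ) : Q u v = ∑ a, v a • Q u (Pi.single a 1) := by
  set Lu : (Fin n → ℝ) →ₗ[ℝ] (Fin n → ℝ) := IsLinearMap.mk' _ (h.linear_right u) with hLu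
  have hv : ∑ a, v a • (Pi.single a (1 : ℝ) : Fin n → ℝ) = v := by
    conv_rhs => rw [← Finset.univ_sum_single v]
    exact Finset.sum_congr rfl fun a _ => by rw [← Pi.single_smul', smul_eq_mul, mul_one]
  calc Q u v = Lu v := rfl
    _ = Lu (∑ a, v a • (Pi.single a (1 : ℝ) : Fin n → ℝ)) := by rw [hv]
    _ = ∑ a, v a • Lu (Pi.single a 1) := by rw [map_sum]; simp only [map_smul]
    _ = ∑ a, v a • Q u (Pi.single a 1) := rfl

/-- **Coordinate form of the bilinear field**:
`Q u v c = Σ_a Σ_a' u_a v_a' · Q(e_a, e_a')_c`. [folklore] -/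
theorem Q_expand (u v : Fin n → ℝ) (c : Fin n) :
    Q u v c = ∑ a, ∑ a', u a * v a' * Q (Pi.single a 1) (Pi.single a' 1) c := by
  rw [h.Q_expand_left u v, Finset.sum_apply]
  refine Finset.sum_congr rfl fun a _ => ?_
  rw [Pi.smul_apply, smul_eq_mul, h.Q_expand_right (Pi.single a 1) v, Finset.sum_apply, Finset.mul_sum]
  refine Finset.sum_congr rfl fun a' _ => ?_
  rw [Pi.smul_apply, smul_eq_mul]
  ring

/-! ### Term-wise differentiation of the Taylor series -/

/-- Absolute summability of the component Taylor series (for the Cauchy product). [folklore] -/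
theorem summable_norm_T {x : Fin n → ℝ} {m s : ℝ} (hx : ∀ c, |x c| ≤ m * w c) (hs : 0 ≤ s)
    (hq : b * m * s < 1) (c : Fin n) : Summable (fun k => ‖T x k c * s ^ k‖) := by
  have hm : 0 ≤ m := h.nonneg_of_wbound c (hx c)
  refine Summable.of_nonneg_of_le (fun k => norm_nonneg _) (fun k => ?_)
    ((h.hasSum_T_majorant hm hs hq).mul_right (w c)).summable
  rw [Real.norm_eq_abs, abs_mul, abs_of_nonneg (pow_nonneg hs k)]
  calc |T x k c| * s ^ k ≤ m * (b * m) ^ k * w c * s ^ k :=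
      mul_le_mul_of_nonneg_right (h.T_bound hx k c) (pow_nonneg hs k)
    _ = m * (b * m) ^ k * s ^ k * w c := by ring

/-- The component Taylor series `σ ↦ Σ_k T x k c σ^k` is differentiable on `(-r, r)` whenever
`b m r < 1`, with derivative the differentiated series. [folklore] -/
theorem hasDerivAt_pseries_T_aux {x : Fin n → ℝ} {m r : ℝ} (hx : ∀ c, |x c| ≤ m * w c)
    (hr : 0 < r) (hq : b * m * r < 1) (c : Fin n) {s : ℝ} (hs : s ∈ Set.Ioo (-r) r) :
    HasDerivAt (fun σ => pseries (T x) σ c)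
      (∑' k, T x (k + 1) c * (((k : ℝ) + 1) * s ^ k)) s := by
  have hm : 0 ≤ m := h.nonneg_of_wbound c (hx c)
  have hb : 0 ≤ b := h.b_nonneg
  have hw : 0 < w c := h.w_pos c
  have hq0 : 0 ≤ b * m * r := mul_nonneg (mul_nonneg hb hm) hr.le
  set u : ℕ → ℝ := fun k => m * w c * ((k : ℝ) * (b * m * r) ^ k) / r with hu
  have hu_sum : Summable u := by
    have hn : ‖b * m * r‖ < 1 := by rwa [Real.norm_eq_abs, abs_of_nonneg hq0]
    exact ((hasSum_coe_mul_geometric_of_norm_lt_one hn).summable.mul_left (m * w c)).div_const r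
  have hderiv : ∀ (k : ℕ) (σ : ℝ), σ ∈ Set.Ioo (-r) r →
      HasDerivAt (fun σ => T x k c * σ ^ k) (T x k c * ((k : ℝ) * σ ^ (k - 1))) σ :=
    fun k σ _ => (hasDerivAt_pow k σ).const_mul _
  have hbound : ∀ (k : ℕ) (σ : ℝ), σ ∈ Set.Ioo (-r) r →
      ‖T x k c * ((k : ℝ) * σ ^ (k - 1))‖ ≤ u k := by
    intro k σ hσ
    have hσr : |σ| ≤ r := (abs_lt.2 hσ).le
    cases k with
    | zero => simp [hu]
    | succ j =>
      rw [Nat.add_sub_cancel, Real.norm_eq_abs, abs_mul, abs_mul, abs_pow, Nat.cast_succ,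
        abs_of_nonneg (by positivity : (0 : ℝ) ≤ (j : ℝ) + 1)]
      have hT := h.T_bound hx (j + 1) c
      have hσj : |σ| ^ j ≤ r ^ j := pow_le_pow_left₀ (abs_nonneg σ) hσr j
      have hbm : 0 ≤ b * m := mul_nonneg hb hm
      calc |T x (j + 1) c| * (((j : ℝ) + 1) * |σ| ^ j)
          ≤ (m * (b * m) ^ (j + 1) * w c) * (((j : ℝ) + 1) * r ^ j) :=
            mul_le_mul hT (mul_le_mul_of_nonneg_left hσj (by positivity)) (by positivity)
              (by positivity)
        _ = u (j + 1) := by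
            simp only [hu]
            push_cast
            field_simp
            ring
  have h0 : (0 : ℝ) ∈ Set.Ioo (-r) r := ⟨by linarith, hr⟩
  have hsum0 : Summable (fun k => T x k c * (0 : ℝ) ^ k) :=
    h.summable_T hx le_rfl (by rw [mul_zero]; exact one_pos) c
  have key := hasDerivAt_tsum_of_isPreconnected hu_sum isOpen_Ioo isPreconnected_Ioo hderiv hbound
    h0 hsum0 hs
  have hsum' : Summable (fun k => T x k c * ((k : ℝ) * s ^ (k - 1))) :=
    Summable.of_norm_bounded hu_sum (fun k => hbound k s hs)
  refine key.congr_deriv ?_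
  rw [hsum'.tsum_eq_zero_add]
  simp only [Nat.cast_zero, zero_mul, mul_zero, zero_add, Nat.cast_succ, Nat.add_sub_cancel]

/-- **The differentiated Taylor series is `Q` of the series** (Cauchy product, coefficientwise the
recursion `(k+1) T x (k+1) = Σ_{i≤k} Q (T x i) (T x (k-i))`). [folklore] -/
theorem tsum_deriv_eq_Q {x : Fin n → ℝ} {m s : ℝ} (hx : ∀ c, |x c| ≤ m * w c) (hs : 0 ≤ s)
    (hq : b * m * s < 1) (c : Fin n) :
    ∑' k, T x (k + 1) c * (((k : ℝ) + 1) * s ^ k) = Q (pseries (T x) s) (pseries (T x) s) c := by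
  have step1 : ∀ k : ℕ, T x (k + 1) c * (((k : ℝ) + 1) * s ^ k) =
      (∑ i ∈ Finset.range (k + 1), Q (T x i) (T x (k - i)) c) * s ^ k := by
    intro k
    rw [← h.T_succ, ← mul_assoc, mul_comm (T x (k + 1) c)]
  have rearr : ∀ (a a' : Fin n) (k : ℕ),
      ∑ i ∈ Finset.range (k + 1), T x i a * s ^ i * (T x (k - i) a' * s ^ (k - i)) =
        (∑ i ∈ Finset.range (k + 1), T x i a * T x (k - i) a') * s ^ k := by
    intro a a' k
    rw [Finset.sum_mul]
    refine Finset.sum_congr rfl fun i hi => ?_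
    have hik : i ≤ k := Nat.lt_succ_iff.mp (Finset.mem_range.mp hi)
    calc T x i a * s ^ i * (T x (k - i) a' * s ^ (k - i))
        = T x i a * T x (k - i) a' * (s ^ i * s ^ (k - i)) := by ring
      _ = T x i a * T x (k - i) a' * s ^ k := by rw [← pow_add, Nat.add_sub_cancel' hik]
  have cauchy : ∀ a a' : Fin n, pseries (T x) s a * pseries (T x) s a' =
      ∑' k, (∑ i ∈ Finset.range (k + 1), T x i a * T x (k - i) a') * s ^ k := by
    intro a a'
    simp only [pseries]
    rw [tsum_mul_tsum_eq_tsum_sum_range_of_summable_norm (h.summable_norm_T hx hs hq a)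
      (h.summable_norm_T hx hs hq a')]
    exact tsum_congr fun k => rearr a a' k
  have hF : ∀ a a' : Fin n, Summable (fun k => (∑ i ∈ Finset.range (k + 1), T x i a * T x (k - i) a') *
      s ^ k * Q (Pi.single a 1) (Pi.single a' 1) c) := by
    intro a a'
    have hS := (summable_norm_sum_mul_range_of_summable_norm (h.summable_norm_T hx hs hq a)
      (h.summable_norm_T hx hs hq a')).of_norm
    exact (hS.congr fun k => rearr a a' k).mul_right _
  have perk : ∀ k : ℕ, (∑ i ∈ Finset.range (k + 1), Q (T x i) (T x (k - i)) c) * s ^ k =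
      ∑ a, ∑ a', (∑ i ∈ Finset.range (k + 1), T x i a * T x (k - i) a') * s ^ k *
        Q (Pi.single a 1) (Pi.single a' 1) c := by
    intro k
    simp_rw [h.Q_expand (T x _) (T x _) c, Finset.sum_mul]
    conv_lhs => rw [Finset.sum_comm]
    refine Finset.sum_congr rfl fun a _ => ?_
    conv_lhs => rw [Finset.sum_comm]
    refine Finset.sum_congr rfl fun a' _ => Finset.sum_congr rfl fun i _ => by ring
  calc ∑' k, T x (k + 1) c * (((k : ℝ) + 1) * s ^ k)
      = ∑' k, ∑ a, ∑ a', (∑ i ∈ Finset.range (k + 1), T x i a * T x (k - i) a') * s ^ k *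
          Q (Pi.single a 1) (Pi.single a' 1) c := tsum_congr fun k => by rw [step1, perk]
    _ = ∑ a, ∑' k, ∑ a', (∑ i ∈ Finset.range (k + 1), T x i a * T x (k - i) a') * s ^ k *
          Q (Pi.single a 1) (Pi.single a' 1) c :=
        Summable.tsum_finsetSum fun a _ => summable_sum fun a' _ => hF a a'
    _ = ∑ a, ∑ a', ∑' k, (∑ i ∈ Finset.range (k + 1), T x i a * T x (k - i) a') * s ^ k *
          Q (Pi.single a 1) (Pi.single a' 1) c :=
        Finset.sum_congr rfl fun a _ => Summable.tsum_finsetSum fun a' _ => hF a a'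
    _ = ∑ a, ∑ a', pseries (T x) s a * pseries (T x) s a' * Q (Pi.single a 1) (Pi.single a' 1) c := by
        refine Finset.sum_congr rfl fun a _ => Finset.sum_congr rfl fun a' _ => ?_
        rw [tsum_mul_right, cauchy]
    _ = Q (pseries (T x) s) (pseries (T x) s) c := (h.Q_expand _ _ c).symm

/-- **The Taylor series solves the equation**: for `|x| ≤ m·w` and `b m r < 1`, on `[0, r)` the vector
series `σ ↦ Σ_k T x k σ^k` has derivative `Q` of itself. [folklore] -/
theorem hasDerivAt_pseries_T {x : Fin n → ℝ} {m r : ℝ} (hx : ∀ c, |x c| ≤ m * w c) (hr : 0 < r)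
    (hq : b * m * r < 1) {s : ℝ} (hs : s ∈ Set.Ico 0 r) :
    HasDerivAt (fun σ => pseries (T x) σ) (Q (pseries (T x) s) (pseries (T x) s)) s := by
  refine hasDerivAt_pi.2 fun c => ?_
  have hm : 0 ≤ m := h.nonneg_of_wbound c (hx c)
  have hqs : b * m * s < 1 := by
    refine lt_of_le_of_lt ?_ hq
    exact mul_le_mul_of_nonneg_left hs.2.le (mul_nonneg h.b_nonneg hm)
  have h1 := h.hasDerivAt_pseries_T_aux hx hr hq c ⟨by linarith [hs.1], hs.2⟩
  rw [h.tsum_deriv_eq_Q hx hs.1 hqs c] at h1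
  exact h1

end IsMajorantSystem

end Summit.NavierStokesRegularity.NavierStokesRegularity.Theorems.TaylorModelMajorant

end
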